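import Summits.CriticalPhenomena.Ising3DConformalLimit.Theorems.EnergyNotSigmaSquaredGapForcesFarMergingRPSchwarzDefs
import Summits.CriticalPhenomena.Ising3DConformalLimit.Theorems.EnergyNotSigmaSquaredGapForcesFarMergingScaleIteration
import HarnessLib

/-!
# Stub R of the line `rp-schwarz-single-pinch`: the one-pinch law read on doubling-regular scales
(crux `GapForcesFarMerging`, item stmt-CriticalPhenomena-4468, route `EnergyNotSigmaSquared`;
registered stub `stub_regularReading : OnePinchLaw → OnePinchLawOnRegularScales`)

`OnePinchLaw` bounds the one-pinch truncation `⟨σ₀σ_{e₂} ; σ_{te₁+p}σ_{te₁+q}⟩` by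
`C t^{-κ} G(te₁)²` (RP normalisation). `OnePinchLawOnRegularScales` asks for the same bound with the
cross-Wick bracket `⟨σ₀σ_{T+p}⟩⟨σ_{e₂}σ_{T+q}⟩ + ⟨σ₀σ_{T+q}⟩⟨σ_{e₂}σ_{T+p}⟩`, `T = 2^k e₁ = dy k`, in
place of `G(T)²`, on the `c₀`-doubling-regular dyadic scales `c₀ G(dy k) ≤ G(dy (k+2))`, for targets in
the cone `‖p‖, ‖q‖ ≤ 2^k`, and records that such scales are unbounded.

* (i) ABUNDANCE with `c₀ = 1/32`: this is `exists_good_scale` of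
  `Theorems/EnergyNotSigmaSquaredGapForcesFarMergingScaleIteration.lean` over the soft package of the
  critical correlators (`softPackageNoBubble_criticalCorr`): were `G(dy (k+2)) < G(dy k)/32` for all
  large `k`, `G` would decay like `32^{-k/2}` along the axis, faster than the Simon–Lieb lower bound
  `c‖x‖⁻²` allows.
* (ii) READING at a regular scale `k`, `t = 2^k`: for in-plane `p` with `‖p‖ ≤ t` the target
  `dy k + p = (t, p₁, p₂)` has sup norm `t` (`norm_dy_add_le`), so the sup-norm
  Messager–Miracle-Solé inequality (`3‖v‖ ≤ ‖w‖ ⇒ G(w) ≤ G(v)`, field `mms` of the package, i.e.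
  `twoPointPlus_le_of_mul_supNorm_le`) gives `⟨σ₀σ_{dy k + p}⟩ ≥ G(dy (k+2)) ≥ c₀ G(dy k)`
  (`criticalTwoPoint_dy_add_two_le`); GKS II on pairs (`gks_pair`, Simon–Lieb form
  `⟨σ_{e₂}σ₀⟩⟨σ₀σ_y⟩ ≤ ⟨σ_{e₂}σ_y⟩`) moves the source to `e₂` at the price of the constant
  `g := ⟨σ_{e₂}σ₀⟩ > 0`. Hence the bracket is `≥ g c₀² G(dy k)²` and the law holds with
  `C ↦ max(C,0) / (g c₀²)`, same `κ`.

References: A. Messager, S. Miracle-Solé, J. Stat. Phys. 17 (1977) 245–262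
[MessagerMiracleSoleJSP1977]; M. Aizenman, H. Duminil-Copin, Ann. Math. 194 (2021), eq. (5.3)
[AizenmanDuminilCopinAnnals2021]; S. Friedli, Y. Velenik, *Statistical Mechanics of Lattice Systems*
(CUP 2017), Thm. 3.20 [FriedliVelenik2017].
-/

noncomputable section

namespace Summit.CriticalPhenomena.Ising3DConformalLimit.GapForcesFarMergingRPSchwarz

open Literature.Probability.LatticeModels
open Summit.CriticalPhenomena.Ising3DConformalLimit.Theses.EnergyNotSigmaSquared
open Summit.CriticalPhenomena.Ising3DConformalLimit.Theorems.GapForcesFarMerging.Negative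
  (e₁ e₂ cc2 softPackageNoBubble_criticalCorr)
open Summit.CriticalPhenomena.Ising3DConformalLimit.EnergyNotSigmaSquaredGapForcesFarMerging.ScaleIteration
  (exists_good_scale norm_single0_nat)

/-! ### (i) Doubling-regular dyadic scales are unbounded -/

/-- `dy k = Pi.single 0 (2^k)`. [folklore] -/
theorem dy_eq_single (k : ℕ) : dy k = Pi.single 0 ((2 ^ k : ℕ) : ℤ) := by
  ext j
  fin_cases j <;> simp [dy, e₁]

/-- `‖dy k‖ = 2^k` (sup norm). [folklore] -/
theorem norm_dy (k : ℕ) : ‖dy k‖ = ((2 ^ k : ℕ) : ℝ) := by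
  rw [dy_eq_single, norm_single0_nat]

/-- **Abundance of doubling-regular scales**: `G(dy k) ≤ 32 G(dy (k+2))` for unboundedly many `k`
(else `G` would decay like `32^{-k/2}` along the axis, against the lower bound `c‖x‖⁻²`;
`exists_good_scale` over `softPackageNoBubble_criticalCorr`). [folklore] -/
theorem regularScales_unbounded (k₀ : ℕ) :
    ∃ k : ℕ, k₀ ≤ k ∧ (1 / 32 : ℝ) * criticalTwoPoint 3 (dy k) ≤ criticalTwoPoint 3 (dy (k + 2)) := by
  obtain ⟨i, hi, h⟩ := exists_good_scale softPackageNoBubble_criticalCorr k₀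
  refine ⟨i + 1, by omega, ?_⟩
  rw [show i + 1 + 2 = i + 3 by ring, dy_eq_single, dy_eq_single, ← criticalCorr_two 3,
    ← criticalCorr_two 3]
  change criticalCorr 3 2 _ ≤ 32 * criticalCorr 3 2 _ at h
  linarith

/-! ### (ii) Lower bounds on the cross-Wick bracket at a regular scale -/

/-- Cone geometry: `‖dy k + p‖ ≤ 2^k` for in-plane `p` (`p₀ = 0`) with `‖p‖ ≤ 2^k` (the supports of
`dy k` and `p` are disjoint, sup norm). [folklore] -/
theorem norm_dy_add_le (k : ℕ) (p : Site 3) (hp : p 0 = 0) (hpn : ‖p‖ ≤ ((2 ^ k : ℕ) : ℝ)) :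
    ‖dy k + p‖ ≤ ((2 ^ k : ℕ) : ℝ) := by
  refine (pi_norm_le_iff_of_nonneg (by positivity)).2 fun j => ?_
  have h1 : ‖p 1‖ ≤ ((2 ^ k : ℕ) : ℝ) := (norm_le_pi_norm p 1).trans hpn
  have h2 : ‖p 2‖ ≤ ((2 ^ k : ℕ) : ℝ) := (norm_le_pi_norm p 2).trans hpn
  fin_cases j
  · simp [dy, e₁, hp, Int.norm_eq_abs]
  · simpa [dy, e₁] using h1
  · simpa [dy, e₁] using h2

/-- **Cone Messager–Miracle-Solé**: `G(dy (k+2)) ≤ ⟨σ₀σ_{dy k + p}⟩` for in-plane `p` in the cone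
`‖p‖ ≤ 2^k` (`3‖dy k + p‖ ≤ 3·2^k ≤ 2^{k+2} = ‖dy (k+2)‖`, sup-norm MMS).
[cite: AizenmanDuminilCopinAnnals2021, eq. (5.3)] -/
theorem criticalTwoPoint_dy_add_two_le (k : ℕ) (p : Site 3) (hp : p 0 = 0)
    (hpn : ‖p‖ ≤ ((2 ^ k : ℕ) : ℝ)) :
    criticalTwoPoint 3 (dy (k + 2)) ≤ cc2 0 (dy k + p) := by
  rw [← criticalCorr_two 3]
  apply softPackageNoBubble_criticalCorr.mms
  have h := norm_dy_add_le k p hp hpn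
  rw [norm_dy]
  push_cast at h ⊢
  calc 3 * ‖dy k + p‖ ≤ 3 * 2 ^ k := by linarith
    _ ≤ 2 ^ (k + 2) := by rw [pow_add]; nlinarith [pow_pos (two_pos : (0 : ℝ) < 2) k]

/-! ### The stub -/

/-- **Stub R — the one-pinch law on doubling-regular scales (cross-Wick reading).** From
`OnePinchLaw` (exponent `κ`, constant `C`): with `c₀ = 1/32`, (i) the `c₀`-doubling-regular dyadic
scales are unbounded (`regularScales_unbounded`), and (ii) at every such scale `k`, for in-plane targets
`p, q` in the cone `‖p‖, ‖q‖ ≤ 2^k`,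
`⟨σ₀σ_{e₂} ; σ_{dy k+p}σ_{dy k+q}⟩ ≤ (max(C,0)/(g c₀²)) (2^k)^{-κ} (⟨σ₀σ_{dy k+p}⟩⟨σ_{e₂}σ_{dy k+q}⟩ + ⟨σ₀σ_{dy k+q}⟩⟨σ_{e₂}σ_{dy k+p}⟩)`,
`g = ⟨σ_{e₂}σ₀⟩`: the one-pinch law at `t = 2^k` and the lower bounds
`⟨σ₀σ_{dy k+p}⟩ ≥ c₀ G(dy k)` (cone MMS + regularity), `⟨σ_{e₂}σ_{dy k+q}⟩ ≥ g c₀ G(dy k)` (GKS II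
on pairs). [cite: MessagerMiracleSoleJSP1977, main theorem (monotonicity of ⟨σ₀σ_x⟩ under reflections)] -/
theorem stub_regularReading : OnePinchLaw → OnePinchLawOnRegularScales := by
  rintro ⟨κ, C, hκ, hlaw⟩
  have hP := softPackageNoBubble_criticalCorr
  have hg : 0 < cc2 e₂ 0 := hP.pos _ _
  refine ⟨κ, max C 0 / (cc2 e₂ 0 * (1 / 32) ^ 2), 1 / 32, hκ, by norm_num, regularScales_unbounded,
    ?_⟩
  intro k hk p q hp hq hpn hqn
  -- the one-pinch law at `t = 2^k` (`((2^k : ℕ) : ℤ) • e₁ = dy k` definitionally)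
  have h1 : pairTrunc 0 e₂ (dy k + p) (dy k + q) ≤
      C * ((2 ^ k : ℕ) : ℝ) ^ (-κ) * criticalTwoPoint 3 (dy k) ^ 2 :=
    hlaw (2 ^ k) Nat.one_le_two_pow p q hp hq
  -- the two lower bounds on the first cross-Wick product
  have hX : (1 / 32 : ℝ) * criticalTwoPoint 3 (dy k) ≤ cc2 0 (dy k + p) :=
    hk.trans (criticalTwoPoint_dy_add_two_le k p hp hpn)
  have hY : cc2 e₂ 0 * ((1 / 32 : ℝ) * criticalTwoPoint 3 (dy k)) ≤ cc2 e₂ (dy k + q) :=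
    (mul_le_mul_of_nonneg_left (hk.trans (criticalTwoPoint_dy_add_two_le k q hq hqn)) hg.le).trans
      (hP.gks_pair e₂ 0 (dy k + q))
  have hG0 : 0 ≤ criticalTwoPoint 3 (dy k) := criticalTwoPoint_nonneg' _
  have hZ : 0 ≤ cc2 0 (dy k + q) * cc2 e₂ (dy k + p) := mul_nonneg (hP.pos _ _).le (hP.pos _ _).le
  have key : cc2 e₂ 0 * (1 / 32) ^ 2 * criticalTwoPoint 3 (dy k) ^ 2 ≤
      cc2 0 (dy k + p) * cc2 e₂ (dy k + q) + cc2 0 (dy k + q) * cc2 e₂ (dy k + p) := by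
    have hXY := mul_le_mul hX hY (by positivity) (hP.pos _ _).le
    nlinarith
  have ht0 : 0 ≤ ((2 ^ k : ℕ) : ℝ) ^ (-κ) := Real.rpow_nonneg (by positivity) _
  have hc : (0 : ℝ) < cc2 e₂ 0 * (1 / 32) ^ 2 := by positivity
  calc pairTrunc 0 e₂ (dy k + p) (dy k + q)
      ≤ C * ((2 ^ k : ℕ) : ℝ) ^ (-κ) * criticalTwoPoint 3 (dy k) ^ 2 := h1
    _ ≤ max C 0 * ((2 ^ k : ℕ) : ℝ) ^ (-κ) * criticalTwoPoint 3 (dy k) ^ 2 := by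
        rw [mul_assoc, mul_assoc]
        exact mul_le_mul_of_nonneg_right (le_max_left _ _) (by positivity)
    _ = max C 0 / (cc2 e₂ 0 * (1 / 32) ^ 2) * ((2 ^ k : ℕ) : ℝ) ^ (-κ) *
          (cc2 e₂ 0 * (1 / 32) ^ 2 * criticalTwoPoint 3 (dy k) ^ 2) := by
        field_simp
    _ ≤ max C 0 / (cc2 e₂ 0 * (1 / 32) ^ 2) * ((2 ^ k : ℕ) : ℝ) ^ (-κ) *
          (cc2 0 (dy k + p) * cc2 e₂ (dy k + q) + cc2 0 (dy k + q) * cc2 e₂ (dy k + p)) :=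
        mul_le_mul_of_nonneg_left key (by positivity)

end Summit.CriticalPhenomena.Ising3DConformalLimit.GapForcesFarMergingRPSchwarz

end
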